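import Summits.ABC.IUTFork.Repair.RHSigmaStrataAbcRecut
import Summits.ABC.IUTFork.Repair.RHHeightClassSigmaLicence
import HarnessLib

/-!
# R-H ROUND 2, Q2 row 8 «heightclass», CELL LEVEL — the abc-ends of p475863 RE-CUT (rh-lead RULING R14, 2026-08-26T23:54:09Z; director-abc R14′
# 23:55:36Z): `hreg ↦ hregBad` (Szpiro-bad locus) and the θ-cut `hreg ↦ hregC` (content locus); and the identity `R_{Σ₈}(T) = R_∅(T)`

PROOF-ONLY file (0 definitions, 0 `Prop` facts, no instance, no notation; nothing re-typed) of the abc-iut cell, rung LADDER-ABC:A2.RP → A2.RESCUE.H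
(seat abc-iut-rp-m2 gen 7 = R-H k2 DESK hand #8, row 8; R14 (3) names this seat as recut author). TAKES NO SIDE on [IUTchIII] Cor. 3.12 or on any author.

WHY. Both theorems of this seat's `Repair/RHHeightClassSigmaAbc.lean` (p475863: `abc_of_offRemainder_sigmaHBand_le_tol`, `abc_of_offPilotGap_sigmaHBand_le_tol`)
and the datum-level `Conditional.abc_of_SHSigma_v10K_window_heightClass` (p475027) carry VERBATIM the BLANKET cone binder `hreg` of the window spine they
ride, and that binder text is KERNEL-REFUTED as typed (abc-iut-C-cert-1 `Conditional.not_hreg_v4`). By R14 (1) they are COMPOSITION RECORDS, VACUOUS AS TYPED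
in [CONE]; they stay in the tree as records. THIS file is the honest cell-level replacement; the datum-level recut of row 8 is abc-iut-rh2-q2-hull's
`RH2SigmaHull.abc_of_hBand_v10K_window_szpiroBadAll` (p476057, `InSig := HBand (pilotDataOfK T.D T.K)` = abc-iut-rh2-xi-2's `InSigma8 T.D` by
`RH.InSigmaDatum.inSigma8_iff`) — cited, not repeated (R14 (3) «preferred, no rival file»). v2 NOTE (docstring only): that explicit-3 recut is ITSELF vacuous
as typed one binder over — its Σ-binder «every Szpiro-bad admissible shallow datum lies in Σ₈» is refuted at the tier-1 Frey datum (abc-iut-rp-m1 probe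
2450c2b258aed9c2 `row8_sigmaBinder_false`; abc-iut-rh2-q2-hull gen 3 `RH2SigmaHull.not_hSigma8Bad`, via `Conditional.not_hSHwBad_frey_holds` ∘ door p470562);
the surviving hull-lane shape is p475597's explicit-2 `abc_of_inSigma_orNum_K_szpiroBad_hregBad` at `InSig := HBand …` (abc-iut-rh2-q2-hull's row instance,
not this seat's). THIS file's ends carry NO Σ-membership binder ([TOL] on the defined number `R_{Σ₈} = R_∅` + `hregBad`/`hregC`) and are untouched by that
refutation (rp-m1's scope list names p478785 explicitly).

WHAT IS TYPED (Σ₈(X) := `RHHeightClassSigmaDoor.sigmaHBand X`, p470903 — the cells `(i, v_ℚ)` of a pilot datum where abc-iut-lens-strengthen-1's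
`RHHeightClass.HBand` packet clause holds: a TRUTH SET in closed form, `(j²−1)·m_q(w) ≤ j·(e_w − r) + (1 − r)` at every bad `w ∣ p`, `p` odd, uniform `e_w`,
certified `r`; `R_σ` = abc-iut-rh2-q2-eq's `RH.SigmaLicence.offRemainder` = procession-normalised positive hull deficits of the cells OUTSIDE `σ`):
* §1 **`offRemainder_sigmaHBand_eq_offRemainder_empty(_of_realises)`** — at the genuine `K`-level bed with realising (resp. the certificates' CHOSEN)
  ideles, **`R_{Σ₈}(X) = R_∅(X)`**: the licence on Σ₈ is a THEOREM (this seat's p475508 `licenceOn_sigmaHBand_pilotDataOfK_chosen`), and a licensed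
  stratum pays exactly the TOTAL positive cell deficit (abc-iut-rh2-q2-eq p476178 `offRemainder_eq_offRemainder_empty_of_licenceOn`). READING (neutral,
  numbers not adjectives): at CELL level the row-8 [TOL] binder of p475863 IS the row-free binder on the ONE datum number `R_∅(T)` — row 8 joins rows
  4/5/5♭ (`R_{Σ₄} = R_{Σ₅} = R_{Σ₅♭} = R_{Σ₈} = R_∅`); what row 8 adds is not a smaller charge but a CLOSED-FORM licensed window, whose complement's
  `(j²−1)`-mass bounds `R_∅` from above (the hull-free / MASS forms are the companion `Repair/RHHeightClassSigmaMassAbc.lean`).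
* §2 THE R14 RECUTS of p475863, riding abc-iut-rh2-q2-eq's R_∅ ends (`RHSigmaStrataAbcRecut`, over abc-iut-rh2-q2-cond's recut cores p476943) — with the
  [LIC] binder GONE (theorem) AND the [NUM, DEEP] binder GONE (q2-eq's `cor312UpTo_offRemainder_empty_chosen` discharges the weakened Corollary at EVERY
  datum): **`abc_of_offRemainder_sigmaHBand_le_tol_szpiroBad_hregBad`** — explicit 2 = [TOL-bad] «`R_{Σ₈(T)}(T) ≤ ((l+1)/4)·5·d*·l` at every genuine datum
  of every SZPIRO-BAD admissible `(P, l)`» · [CONE-bad] `hregBad` (abc-iut-C-cert-2 p452637 VERBATIM) ⟹ `ABC`; **`abc_of_offRemainder_sigmaHBand_le_tol_content_hregC`**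
  — the θ-CUT (director's socket): [TOL-C] · [CONE-C] `hregC` (abc-iut-C-cert-1's binder VERBATIM) demanded ONLY on the content locus
  «`6(1 + 20 d_mod/l)(log-diff + log-cond) + 120·d*·l < log q^{∤{2,l}}(λ)`». The recut of p475863's HULL-FREE end `abc_of_offPilotGap_sigmaHBand_le_tol`
  and its MASS form («`mass(Σ₈) ≥ M − Tol_K`», abc-iut-rh2-T-1's `offTrivialMass` currency) are the companion `Repair/RHHeightClassSigmaMassAbc.lean`.
COUNTS: binder by binder every theorem here is WEAKER-OR-EQUAL than p475863's (3 displayed hypotheses ↦ 2; `hreg ⟹ hregBad ⟹ hregC` by premise drop;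
the Szpiro-bad / content guards only remove instances), hence STRONGER as a certificate, and NO binder is kernel-refuted (`not_hreg_v4` does not
elaborate against the guarded texts). HONEST SCOPE: [TOL]/[TOL-TRIV] are ASSUMPTION LABELS on DEFINED numbers, refutable datum by datum — R-H READING
v1.1 Q1′ = Q3: on genuine data the off-Σ₈ mass is within tolerance essentially iff the WHOLE datum lies in Σ₈ (`l ≥ l₀(datum)`), and abc-iut-rh-tst-5
reads the R_∅ tolerance FALSE on paper on a Szpiro-bad family at `l = 11`; nothing here says any genuine datum satisfies a binder; «`ABC` follows from
these hypotheses AS TYPED», nothing more; Σ₈ / `HBand` / `LicenceOn` are reading predicates (claim-tagged by their typers); refuted-as-typed ≠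
refuted-in-print; typed ≠ proved; instantiated ≠ endorsed; no side taken on Mochizuki / Scholze–Stix / Joshi / Dupuy–Hilado. [claim: Mochizuki2012, status: disputed]
[cite: Mochizuki2012, IUTchIII Cor. 3.12 p. 173–174, Step (xi-f) p. 184; IUTchIV Thm. 1.10 pp. 22–31 (Step (v) p. 27–28, (viii) p. 30), Cor. 2.2 (ii) pp. 44–46;
IUTchI Ex. 3.2 (iv) p. 71] [cite: DupuyHilado2025, §3.3, §3.9, Thm. 3.10.1] Axioms: standard.
-/

noncomputable section

open Set Function NumberField IsDedekindDomain

namespace Summit.ABC.IUTFork.Repair.RHHeightClassSigmaAbc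

open Summit.ABC.IUTFork.Thm311 Summit.ABC.IUTFork.Thm311.Real Summit.ABC.IUTFork.Cor312 Summit.ABC.IUTFork.Cor312.Setting
  Summit.ABC.IUTFork.Cor312Vol Summit.ABC.IUTFork.Cor312Prov Literature.IUT.LogThetaLattice Literature.IUT.LogVolume
  Literature.IUT.HodgeTheaters Literature.IUT.LogVolume.ThetaData Literature.NumberTheory.NumberFields
  Literature.NumberTheory.GaloisRepresentations.Ultrametric
  Literature.NumberTheory.DiophantineGeometry.GenEll Summit.ABC.ABC.Theorems
  Summit.ABC.IUTFork.Repair.RH.SigmaLicence Summit.ABC.IUTFork.Repair.RH.SigmaStrataEq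
  Summit.ABC.IUTFork.Conditional

/-! ## §1. `R_{Σ₈} = R_∅` at the genuine bed -/

section Genuine

variable {F K Fbar : Type} [Field F] [NumberField F] [Field K] [NumberField K] [Algebra F K] [Field Fbar]
  [Algebra F Fbar] [Algebra K Fbar] {E : WeierstrassCurve F} [E.IsElliptic] {l : ℕ} {Pb : BadPlacePredicates K}
  (D : InitialThetaData F K Fbar E l Pb) (M : Type) [Field M] [NumberField M] {logv : PadicLogs K} (hlog : LogvAnalytic logv)
  (archPk : ∀ (j : (thetaIndex (pilotDataOfK D K)).Label) (vQ : (thetaIndex (pilotDataOfK D K)).VQ),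
    Set ((logShellsDH (pilotDataOfK D K) logv).Packet j vQ))
  (archSub : ∀ (j : (thetaIndex (pilotDataOfK D K)).Label) (v : (thetaIndex (pilotDataOfK D K)).V),
    Set ((logShellsDH (pilotDataOfK D K) logv).Packet j ((thetaIndex (pilotDataOfK D K)).over v)))
  (Ψ : ℤ → ∀ v : (thetaIndex (pilotDataOfK D K)).V, v ∈ (thetaIndex (pilotDataOfK D K)).Vbad →
    Set ((logShellsDH (pilotDataOfK D K) logv).StarPacket v))
  (act : ℤ → ∀ v : (thetaIndex (pilotDataOfK D K)).V, v ∈ (thetaIndex (pilotDataOfK D K)).Vbad →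
    (logShellsDH (pilotDataOfK D K) logv).StarPacket v → Module.End ℚ ((logShellsDH (pilotDataOfK D K) logv).StarPacket v))
  (Mmod : ℤ → ∀ j : (thetaIndex (pilotDataOfK D K)).LabelStar, Set ((logShellsDH (pilotDataOfK D K) logv).GlobalPacket j.1))
  (region : ℤ → ∀ j : (thetaIndex (pilotDataOfK D K)).LabelStar, FinDivisor M → ∀ vQ : (thetaIndex (pilotDataOfK D K)).VQ,
    Set ((logShellsDH (pilotDataOfK D K) logv).Packet j.1 vQ))
  (n : ℤ) {HT : Type} {LogLink : HT → HT → Type} {IsFull : ∀ {s t : HT}, LogLink s t → Prop}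
  (lat : LGPGaussianLogThetaLattice LogLink IsFull)
  {Frd : Type} {IsoF : Frd → Frd → Type} {Ob : Frd → Type} {realify : Frd → Frd} {Strip : Type}
  {IsoS : Strip → Strip → Type}
  {Mv : ∀ v : (thetaIndex (pilotDataOfK D K)).V, v ∈ (thetaIndex (pilotDataOfK D K)).Vbad → Type} [∀ v h, Monoid (Mv v h)]
  (sig : GlobalLGPFrobenioidSignature (thetaIndex (pilotDataOfK D K)).lstar (thetaIndex (pilotDataOfK D K)).V
    (· ∈ (thetaIndex (pilotDataOfK D K)).Vbad) Frd IsoF Ob realify Strip IsoS Mv)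
  (split : SplittingMonoids Mv) {ObΔ : Type}
  {N : ∀ v : (thetaIndex (pilotDataOfK D K)).V, v ∈ (thetaIndex (pilotDataOfK D K)).Vbad → Type} [∀ v h, Monoid (N v h)]
  (qData : QPilotData ObΔ N)
  (tq : ∀ (pp : Nat.Primes) (x : (thetaIndex (pilotDataOfK D K)).Fibre (.inr pp)),
    haveI : Fact (pp : ℕ).Prime := ⟨pp.2⟩; kOf (pilotDataOfK D K) pp.1 x)
  (t : ∀ (pp : Nat.Primes) (_ : Fin (pilotDataOfK D K).lstar) (x : (thetaIndex (pilotDataOfK D K)).Fibre (.inr pp)),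
    haveI : Fact (pp : ℕ).Prime := ⟨pp.2⟩; kOf (pilotDataOfK D K) pp.1 x)
  (htq0 : ∀ pp x, tq pp x ≠ 0)
  (htq1 : ∀ (pp : Nat.Primes) (x : (thetaIndex (pilotDataOfK D K)).Fibre (.inr pp)),
    haveI : Fact (pp : ℕ).Prime := ⟨pp.2⟩; placeOf (pilotDataOfK D K) pp.1 x ∉ (pilotDataOfK D K).S → ‖tq pp x‖ = 1)

/-- **`R_{Σ₈} = R_∅` AT THE GENUINE BED, ANY REALISING IDELES.** At abc-iut-c312-7's sharp print-normalised setting of `pilotDataOfK D K`, for Θ- and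
q-ideles REALISING the pilot divisors in Dupuy–Hilado's normalisation (units off `S`), the off-Σ₈ remainder of OUR typed hull IS the total positive
cell deficit: the licence on Σ₈ is a theorem (`licenceOn_sigmaHBand_pilotDataOfK_of_realises`, p475508) and licensed cells have deficit `≤ 0`
(abc-iut-rh2-q2-eq `offRemainder_eq_offRemainder_empty_of_licenceOn`, p476178). [cite: Mochizuki2012, IUTchI Ex. 3.2 (iv) p. 71]
[cite: DupuyHilado2025, §3.3, §3.4, §3.9] [claim: Mochizuki2012, status: disputed] -/
theorem offRemainder_sigmaHBand_eq_offRemainder_empty_of_realises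
    (ht0 : ∀ pp i x, t pp i x ≠ 0)
    (ht1 : ∀ (pp : Nat.Primes) (i : Fin (pilotDataOfK D K).lstar) (x : (thetaIndex (pilotDataOfK D K)).Fibre (.inr pp)),
      haveI : Fact (pp : ℕ).Prime := ⟨pp.2⟩; placeOf (pilotDataOfK D K) pp.1 x ∉ (pilotDataOfK D K).S → ‖t pp i x‖ = 1)
    (ht : ∀ (pp : Nat.Primes) (i : Fin (pilotDataOfK D K).lstar) (x : (thetaIndex (pilotDataOfK D K)).Fibre (.inr pp)),
      haveI : Fact (pp : ℕ).Prime := ⟨pp.2⟩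
      Real.log ‖t pp i x‖ = -((pilotDataOfK D K).thetaPilot i (placeOf (pilotDataOfK D K) pp.1 x)) *
        logNorm K (placeOf (pilotDataOfK D K) pp.1 x) / localDegree K (placeOf (pilotDataOfK D K) pp.1 x))
    (htq : ∀ (pp : Nat.Primes) (x : (thetaIndex (pilotDataOfK D K)).Fibre (.inr pp)),
      haveI : Fact (pp : ℕ).Prime := ⟨pp.2⟩
      Real.log ‖tq pp x‖ = -((pilotDataOfK D K).qPilot (placeOf (pilotDataOfK D K) pp.1 x)) *
        logNorm K (placeOf (pilotDataOfK D K) pp.1 x) / localDegree K (placeOf (pilotDataOfK D K) pp.1 x)) :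
    offRemainder (settingPrVolSharp (pilotDataOfK D K) hlog M archPk archSub Ψ act Mmod region n lat sig split qData tq t htq0 htq1)
        (RHHeightClassSigmaDoor.sigmaHBand (pilotDataOfK D K)) =
      offRemainder (settingPrVolSharp (pilotDataOfK D K) hlog M archPk archSub Ψ act Mmod region n lat sig split qData tq t htq0 htq1) ∅ :=
  offRemainder_eq_offRemainder_empty_of_licenceOn
    (bridgeHyps_settingPrVolSharp_of_ideles (pilotDataOfK D K) hlog M archPk archSub Ψ act Mmod region n lat sig split qData t tq
      ht0 ht1 htq0 htq1)
    (RHHeightClassSigmaLicence.licenceOn_sigmaHBand_pilotDataOfK_of_realises D M hlog archPk archSub Ψ act Mmod region n lat sig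
      split qData tq t htq0 htq1 ht0 ht htq)

end Genuine

section Chosen

variable {F K Fbar : Type} [Field F] [NumberField F] [Field K] [NumberField K] [Algebra F K] [Field Fbar]
  [Algebra F Fbar] [Algebra K Fbar] {E : WeierstrassCurve F} [E.IsElliptic] {l : ℕ} {Pb : BadPlacePredicates K}
  (D : InitialThetaData F K Fbar E l Pb) (M : Type) [Field M] [NumberField M]
  (archPk : ∀ (j : (thetaIndex (pilotDataOfK D K)).Label) (vQ : (thetaIndex (pilotDataOfK D K)).VQ),
    Set ((logShellsDH (pilotDataOfK D K) (analyticLogv K)).Packet j vQ))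
  (archSub : ∀ (j : (thetaIndex (pilotDataOfK D K)).Label) (v : (thetaIndex (pilotDataOfK D K)).V),
    Set ((logShellsDH (pilotDataOfK D K) (analyticLogv K)).Packet j ((thetaIndex (pilotDataOfK D K)).over v)))
  (Ψ : ℤ → ∀ v : (thetaIndex (pilotDataOfK D K)).V, v ∈ (thetaIndex (pilotDataOfK D K)).Vbad →
    Set ((logShellsDH (pilotDataOfK D K) (analyticLogv K)).StarPacket v))
  (act : ℤ → ∀ v : (thetaIndex (pilotDataOfK D K)).V, v ∈ (thetaIndex (pilotDataOfK D K)).Vbad →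
    (logShellsDH (pilotDataOfK D K) (analyticLogv K)).StarPacket v →
      Module.End ℚ ((logShellsDH (pilotDataOfK D K) (analyticLogv K)).StarPacket v))
  (Mmod : ℤ → ∀ j : (thetaIndex (pilotDataOfK D K)).LabelStar, Set ((logShellsDH (pilotDataOfK D K) (analyticLogv K)).GlobalPacket j.1))
  (region : ℤ → ∀ j : (thetaIndex (pilotDataOfK D K)).LabelStar, FinDivisor M → ∀ vQ : (thetaIndex (pilotDataOfK D K)).VQ,
    Set ((logShellsDH (pilotDataOfK D K) (analyticLogv K)).Packet j.1 vQ))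
  (n : ℤ) {HT : Type} {LogLink : HT → HT → Type} {IsFull : ∀ {s t : HT}, LogLink s t → Prop}
  (lat : LGPGaussianLogThetaLattice LogLink IsFull)
  {Frd : Type} {IsoF : Frd → Frd → Type} {Ob : Frd → Type} {realify : Frd → Frd} {Strip : Type}
  {IsoS : Strip → Strip → Type}
  {Mv : ∀ v : (thetaIndex (pilotDataOfK D K)).V, v ∈ (thetaIndex (pilotDataOfK D K)).Vbad → Type} [∀ v h, Monoid (Mv v h)]
  (sig : GlobalLGPFrobenioidSignature (thetaIndex (pilotDataOfK D K)).lstar (thetaIndex (pilotDataOfK D K)).V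
    (· ∈ (thetaIndex (pilotDataOfK D K)).Vbad) Frd IsoF Ob realify Strip IsoS Mv)
  (split : SplittingMonoids Mv) {ObΔ : Type}
  {N : ∀ v : (thetaIndex (pilotDataOfK D K)).V, v ∈ (thetaIndex (pilotDataOfK D K)).Vbad → Type} [∀ v h, Monoid (N v h)]
  (qData : QPilotData ObΔ N)

/-- **`R_{Σ₈} = R_∅` AT THE CERTIFICATES' CHOSEN REALISING IDELES — hypothesis-free.** At the genuine bed with the coric shells of `analyticLogv K`
and the realising q- and Θ-ideles chosen in the window certificates (`Cor312Prov.exists_realising_{q,theta}Ideles_pilotDataOfK`), the off-Σ₈ remainder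
of every abc-end of record equals the row-free number `R_∅`. The rewrite along which p475863's [TOL] binder reads as abc-iut-rh2-q2-eq's R_∅ binder.
[cite: Mochizuki2012, IUTchI Ex. 3.2 (iv) p. 71] [cite: DupuyHilado2025, §3.3, §3.9] [claim: Mochizuki2012, status: disputed] -/
theorem offRemainder_sigmaHBand_eq_offRemainder_empty :
    offRemainder
        (settingPrVolSharp (pilotDataOfK D K) (logvAnalytic_analyticLogv (F := K)) M archPk archSub Ψ act Mmod region n lat sig split qData
          (exists_realising_qIdeles_pilotDataOfK D).choose (exists_realising_thetaIdeles_pilotDataOfK D).choose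
          (exists_realising_qIdeles_pilotDataOfK D).choose_spec.1 (exists_realising_qIdeles_pilotDataOfK D).choose_spec.2.1)
        (RHHeightClassSigmaDoor.sigmaHBand (pilotDataOfK D K)) =
      offRemainder
        (settingPrVolSharp (pilotDataOfK D K) (logvAnalytic_analyticLogv (F := K)) M archPk archSub Ψ act Mmod region n lat sig split qData
          (exists_realising_qIdeles_pilotDataOfK D).choose (exists_realising_thetaIdeles_pilotDataOfK D).choose
          (exists_realising_qIdeles_pilotDataOfK D).choose_spec.1 (exists_realising_qIdeles_pilotDataOfK D).choose_spec.2.1) ∅ :=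
  offRemainder_sigmaHBand_eq_offRemainder_empty_of_realises D M (logvAnalytic_analyticLogv (F := K)) archPk archSub Ψ act Mmod region
    n lat sig split qData (exists_realising_qIdeles_pilotDataOfK D).choose (exists_realising_thetaIdeles_pilotDataOfK D).choose
    (exists_realising_qIdeles_pilotDataOfK D).choose_spec.1 (exists_realising_qIdeles_pilotDataOfK D).choose_spec.2.1
    (exists_realising_thetaIdeles_pilotDataOfK D).choose_spec.1 (exists_realising_thetaIdeles_pilotDataOfK D).choose_spec.2.1
    (exists_realising_thetaIdeles_pilotDataOfK D).choose_spec.2.2 (exists_realising_qIdeles_pilotDataOfK D).choose_spec.2.2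

end Chosen

/-! ## §2. The R14 recuts of p475863's `abc_of_offRemainder_sigmaHBand_le_tol` — column data of the certificates ONCE, then the two ends -/

section Recut

variable
    (M : ∀ (P : NFPoint) (l : ℕ) (T : Cor22.ThetaVolumeDatumAt P l), Type) [∀ P l T, Field (M P l T)] [∀ P l T, NumberField (M P l T)]
    (archPk : ∀ (P : NFPoint) (l : ℕ) (T : Cor22.ThetaVolumeDatumAt P l), letI := T.instFieldF; letI := T.instNumberFieldF; letI := T.instAlgebraF; letI := T.instFieldK;
        letI := T.instNumberFieldK; letI := T.instAlgebraK; letI := T.instFieldFbar; letI := T.instAlgebraFbar;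
        letI := T.instAlgebraKFbar; letI := T.instIsElliptic;
      ∀ (j : (thetaIndex (pilotDataOfK T.D T.K)).Label) (vQ : (thetaIndex (pilotDataOfK T.D T.K)).VQ), Set ((logShellsDH (pilotDataOfK T.D T.K) (analyticLogv T.K)).Packet j vQ))
    (archSub : ∀ (P : NFPoint) (l : ℕ) (T : Cor22.ThetaVolumeDatumAt P l), letI := T.instFieldF; letI := T.instNumberFieldF; letI := T.instAlgebraF; letI := T.instFieldK;
        letI := T.instNumberFieldK; letI := T.instAlgebraK; letI := T.instFieldFbar; letI := T.instAlgebraFbar;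
        letI := T.instAlgebraKFbar; letI := T.instIsElliptic;
      ∀ (j : (thetaIndex (pilotDataOfK T.D T.K)).Label) (v : (thetaIndex (pilotDataOfK T.D T.K)).V), Set ((logShellsDH (pilotDataOfK T.D T.K) (analyticLogv T.K)).Packet j ((thetaIndex (pilotDataOfK T.D T.K)).over v)))
    (Ψ : ∀ (P : NFPoint) (l : ℕ) (T : Cor22.ThetaVolumeDatumAt P l), letI := T.instFieldF; letI := T.instNumberFieldF; letI := T.instAlgebraF; letI := T.instFieldK;
        letI := T.instNumberFieldK; letI := T.instAlgebraK; letI := T.instFieldFbar; letI := T.instAlgebraFbar;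
        letI := T.instAlgebraKFbar; letI := T.instIsElliptic;
      ℤ → ∀ v : (thetaIndex (pilotDataOfK T.D T.K)).V, v ∈ (thetaIndex (pilotDataOfK T.D T.K)).Vbad → Set ((logShellsDH (pilotDataOfK T.D T.K) (analyticLogv T.K)).StarPacket v))
    (act : ∀ (P : NFPoint) (l : ℕ) (T : Cor22.ThetaVolumeDatumAt P l), letI := T.instFieldF; letI := T.instNumberFieldF; letI := T.instAlgebraF; letI := T.instFieldK;
        letI := T.instNumberFieldK; letI := T.instAlgebraK; letI := T.instFieldFbar; letI := T.instAlgebraFbar;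
        letI := T.instAlgebraKFbar; letI := T.instIsElliptic;
      ℤ → ∀ v : (thetaIndex (pilotDataOfK T.D T.K)).V, v ∈ (thetaIndex (pilotDataOfK T.D T.K)).Vbad → (logShellsDH (pilotDataOfK T.D T.K) (analyticLogv T.K)).StarPacket v → Module.End ℚ ((logShellsDH (pilotDataOfK T.D T.K) (analyticLogv T.K)).StarPacket v))
    (Mmod : ∀ (P : NFPoint) (l : ℕ) (T : Cor22.ThetaVolumeDatumAt P l), letI := T.instFieldF; letI := T.instNumberFieldF; letI := T.instAlgebraF; letI := T.instFieldK;
        letI := T.instNumberFieldK; letI := T.instAlgebraK; letI := T.instFieldFbar; letI := T.instAlgebraFbar;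
        letI := T.instAlgebraKFbar; letI := T.instIsElliptic;
      ℤ → ∀ j : (thetaIndex (pilotDataOfK T.D T.K)).LabelStar, Set ((logShellsDH (pilotDataOfK T.D T.K) (analyticLogv T.K)).GlobalPacket j.1))
    (region : ∀ (P : NFPoint) (l : ℕ) (T : Cor22.ThetaVolumeDatumAt P l), letI := T.instFieldF; letI := T.instNumberFieldF; letI := T.instAlgebraF; letI := T.instFieldK;
        letI := T.instNumberFieldK; letI := T.instAlgebraK; letI := T.instFieldFbar; letI := T.instAlgebraFbar;
        letI := T.instAlgebraKFbar; letI := T.instIsElliptic;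
      ℤ → ∀ j : (thetaIndex (pilotDataOfK T.D T.K)).LabelStar, FinDivisor (M P l T) → ∀ vQ : (thetaIndex (pilotDataOfK T.D T.K)).VQ, Set ((logShellsDH (pilotDataOfK T.D T.K) (analyticLogv T.K)).Packet j.1 vQ))
    (n : ∀ (P : NFPoint) (l : ℕ) (T : Cor22.ThetaVolumeDatumAt P l), ℤ)
    {HT : ∀ (P : NFPoint) (l : ℕ) (T : Cor22.ThetaVolumeDatumAt P l), Type} {LogLink : ∀ (P : NFPoint) (l : ℕ) (T : Cor22.ThetaVolumeDatumAt P l), HT P l T → HT P l T → Type}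
    {IsFull : ∀ (P : NFPoint) (l : ℕ) (T : Cor22.ThetaVolumeDatumAt P l), ∀ {s t : HT P l T}, LogLink P l T s t → Prop}
    (lat : ∀ (P : NFPoint) (l : ℕ) (T : Cor22.ThetaVolumeDatumAt P l), LGPGaussianLogThetaLattice (LogLink P l T) (IsFull P l T))
    {Frd : ∀ (P : NFPoint) (l : ℕ) (T : Cor22.ThetaVolumeDatumAt P l), Type} {IsoF : ∀ (P : NFPoint) (l : ℕ) (T : Cor22.ThetaVolumeDatumAt P l), Frd P l T → Frd P l T → Type} {Ob : ∀ (P : NFPoint) (l : ℕ) (T : Cor22.ThetaVolumeDatumAt P l), Frd P l T → Type}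
    {realify : ∀ (P : NFPoint) (l : ℕ) (T : Cor22.ThetaVolumeDatumAt P l), Frd P l T → Frd P l T} {Strip : ∀ (P : NFPoint) (l : ℕ) (T : Cor22.ThetaVolumeDatumAt P l), Type} {IsoS : ∀ (P : NFPoint) (l : ℕ) (T : Cor22.ThetaVolumeDatumAt P l), Strip P l T → Strip P l T → Type}
    {Mv : ∀ (P : NFPoint) (l : ℕ) (T : Cor22.ThetaVolumeDatumAt P l), letI := T.instFieldF; letI := T.instNumberFieldF; letI := T.instAlgebraF; letI := T.instFieldK;
        letI := T.instNumberFieldK; letI := T.instAlgebraK; letI := T.instFieldFbar; letI := T.instAlgebraFbar;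
        letI := T.instAlgebraKFbar; letI := T.instIsElliptic;
      ∀ v : (thetaIndex (pilotDataOfK T.D T.K)).V, v ∈ (thetaIndex (pilotDataOfK T.D T.K)).Vbad → Type}
    [∀ P l T v h, Monoid (Mv P l T v h)]
    (sig : ∀ (P : NFPoint) (l : ℕ) (T : Cor22.ThetaVolumeDatumAt P l), letI := T.instFieldF; letI := T.instNumberFieldF; letI := T.instAlgebraF; letI := T.instFieldK;
        letI := T.instNumberFieldK; letI := T.instAlgebraK; letI := T.instFieldFbar; letI := T.instAlgebraFbar;
        letI := T.instAlgebraKFbar; letI := T.instIsElliptic;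
      GlobalLGPFrobenioidSignature (thetaIndex (pilotDataOfK T.D T.K)).lstar (thetaIndex (pilotDataOfK T.D T.K)).V (· ∈ (thetaIndex (pilotDataOfK T.D T.K)).Vbad) (Frd P l T) (IsoF P l T) (Ob P l T) (realify P l T)
        (Strip P l T) (IsoS P l T) (Mv P l T))
    (split : ∀ (P : NFPoint) (l : ℕ) (T : Cor22.ThetaVolumeDatumAt P l), SplittingMonoids (Mv P l T))
    {ObΔ : ∀ (P : NFPoint) (l : ℕ) (T : Cor22.ThetaVolumeDatumAt P l), Type} {N : ∀ (P : NFPoint) (l : ℕ) (T : Cor22.ThetaVolumeDatumAt P l), letI := T.instFieldF; letI := T.instNumberFieldF; letI := T.instAlgebraF; letI := T.instFieldK;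
        letI := T.instNumberFieldK; letI := T.instAlgebraK; letI := T.instFieldFbar; letI := T.instAlgebraFbar;
        letI := T.instAlgebraKFbar; letI := T.instIsElliptic;
      ∀ v : (thetaIndex (pilotDataOfK T.D T.K)).V, v ∈ (thetaIndex (pilotDataOfK T.D T.K)).Vbad → Type}
    [∀ P l T v h, Monoid (N P l T v h)] (qData : ∀ (P : NFPoint) (l : ℕ) (T : Cor22.ThetaVolumeDatumAt P l), QPilotData (ObΔ P l T) (N P l T))

include M archPk archSub Ψ act Mmod region n lat sig split qData

/-- **`abc_of_offRemainder_sigmaHBand_le_tol_szpiroBad_hregBad` — R14 (3) RECUT of p475863's `abc_of_offRemainder_sigmaHBand_le_tol`.** Explicit 2 =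
[TOL-bad] «at every SZPIRO-BAD admissible `(P, l)` and every genuine Θ-volume datum `T`, the off-Σ₈(T) remainder of OUR typed hull at the chosen
realising ideles is within abc-iut-rh2-q2-cond's tolerance, `R_{Σ₈(T)}(T) ≤ ((l+1)/4)·5·d*·l`» · [CONE-bad] `hregBad` (abc-iut-C-cert-2 p452637 VERBATIM)
⟹ `ABC`, print's constants unchanged. The [LIC, WINDOW] binder of the record is a THEOREM (p475508) and the [NUM, DEEP] binder is GONE
(abc-iut-rh2-q2-eq `cor312UpTo_offRemainder_empty_chosen`): q2-eq's `abc_of_offRemainder_empty_le_tol_szpiroBad_hregBad` along §1's `R_{Σ₈} = R_∅`.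
At Szpiro-good admissible points NOTHING is assumed; no binder here is kernel-refuted. CONDITIONAL; «`ABC` follows from these hypotheses AS TYPED»,
nothing more; no side taken on [IUTchIII] Cor. 3.12. [cite: Mochizuki2012, IUTchIV Thm. 1.10 pp. 22–31; Cor. 2.2–2.3 pp. 41–55]
[cite: Mochizuki2012, IUTchIII Cor. 3.12 p. 174] [claim: Mochizuki2012, status: disputed] -/
theorem abc_of_offRemainder_sigmaHBand_le_tol_szpiroBad_hregBad
    -- [TOL, Szpiro-bad] the off-Σ₈ remainder at the chosen realising ideles is within q2-cond's tolerance, at Szpiro-bad admissible data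
    (hTolBad : ∀ P : NFPoint, P ∈ UP → ∀ l : ℕ, l.Prime → 5 ≤ l →
      Cor22.AdmitsCore P → Cor22.CondP2 P l → Cor22.CondP5 P l → Cor22.CondP6 P l →
      (((l : ℝ) + 5) / 4 < (Cor22.dmod P : ℝ) ∨
        6 * l * (((l : ℝ) + 5) - 4 * Cor22.dmod P) / (((l : ℝ) + 4) * ((l : ℝ) - 3))
            * (P.logDiff + (1 - 1 / (l : ℝ)) * Cor22.logCondAvoid P {2, l})
          + 6 * l * ((l : ℝ) + 5) / (((l : ℝ) + 4) * ((l : ℝ) - 3)) * Real.log Real.pi < Cor22.logQAvoid P {2, l}) →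
      ∀ T : Cor22.ThetaVolumeDatumAt P l, letI := T.instFieldF; letI := T.instNumberFieldF; letI := T.instAlgebraF; letI := T.instFieldK;
        letI := T.instNumberFieldK; letI := T.instAlgebraK; letI := T.instFieldFbar; letI := T.instAlgebraFbar;
        letI := T.instAlgebraKFbar; letI := T.instIsElliptic;
      offRemainder
        (settingPrVolSharp (pilotDataOfK T.D T.K) (logvAnalytic_analyticLogv (F := T.K)) (M P l T) (archPk P l T) (archSub P l T) (Ψ P l T)
          (act P l T) (Mmod P l T) (region P l T) (n P l T) (lat P l T) (sig P l T) (split P l T) (qData P l T)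
          (exists_realising_qIdeles_pilotDataOfK T.D).choose
          (exists_realising_thetaIdeles_pilotDataOfK T.D).choose
          (exists_realising_qIdeles_pilotDataOfK T.D).choose_spec.1
          (exists_realising_qIdeles_pilotDataOfK T.D).choose_spec.2.1)
        (RHHeightClassSigmaDoor.sigmaHBand (pilotDataOfK T.D T.K)) ≤
        ((l : ℝ) + 1) / 4 * (5 * ((((2 ^ 12 * 3 ^ 3 * 5 * Cor22.dmod P : ℕ) : ℝ)) * l)))
    -- [CONE, Szpiro-bad] the off-regime hull estimate with print's `B_III(P,l)`, ONLY at Szpiro-bad admissible points (p452637 VERBATIM)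
    (hregBad : ∀ P : NFPoint, P ∈ UP → ∀ l : ℕ, l.Prime → 5 ≤ l →
      Cor22.AdmitsCore P → Cor22.CondP2 P l → Cor22.CondP5 P l → Cor22.CondP6 P l →
      (((l : ℝ) + 5) / 4 < (Cor22.dmod P : ℝ) ∨
        6 * l * (((l : ℝ) + 5) - 4 * Cor22.dmod P) / (((l : ℝ) + 4) * ((l : ℝ) - 3))
            * (P.logDiff + (1 - 1 / (l : ℝ)) * Cor22.logCondAvoid P {2, l})
          + 6 * l * ((l : ℝ) + 5) / (((l : ℝ) + 4) * ((l : ℝ) - 3)) * Real.log Real.pi < Cor22.logQAvoid P {2, l}) →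
      ∀ T : Cor22.ThetaVolumeDatumAt P l,
        (letI := T.instFieldF; letI := T.instNumberFieldF; letI := T.instAlgebraF; letI := T.instFieldK
         letI := T.instNumberFieldK; letI := T.instAlgebraK; letI := T.instFieldFbar; letI := T.instAlgebraFbar
         letI := T.instAlgebraKFbar; letI := T.instIsElliptic
         ¬ (∀ p ∈ T.I.supportPrimes, ∀ v w : placesOver (fieldOfModuli T.E) p,
            (Summit.ABC.IUTFork.DHData.ofInput T.I).logQloc p v = (Summit.ABC.IUTFork.DHData.ofInput T.I).logQloc p w)) →
        T.HullEstimateOf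
          (((l : ℝ) + 1) / 4 *
            ((1 + 12 * (Cor22.dmod P : ℝ) / l) * (P.logDiff + Cor22.logCondAvoid P {2, l})
              + 2 * Real.log l + 52
              + 20 / 3 * Real.log (((2 ^ 12 * 3 ^ 3 * 5 * Cor22.dmod P : ℕ) : ℝ) * (l : ℝ))
                * (Nat.primeCounting (2 ^ 12 * 3 ^ 3 * 5 * Cor22.dmod P * l) : ℝ))))
    : _root_.ABC :=
  RH.SigmaStrataEq.abc_of_offRemainder_empty_le_tol_szpiroBad_hregBad M archPk archSub Ψ act Mmod region n lat sig split qData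
    (fun P hP l hl h5 hc h2 h5' h6 hg T => by
      letI := T.instFieldF; letI := T.instNumberFieldF; letI := T.instAlgebraF; letI := T.instFieldK
      letI := T.instNumberFieldK; letI := T.instAlgebraK; letI := T.instFieldFbar; letI := T.instAlgebraFbar
      letI := T.instAlgebraKFbar; letI := T.instIsElliptic
      exact (offRemainder_sigmaHBand_eq_offRemainder_empty T.D (M P l T) (archPk P l T) (archSub P l T) (Ψ P l T) (act P l T)
        (Mmod P l T) (region P l T) (n P l T) (lat P l T) (sig P l T) (split P l T) (qData P l T)).symm.trans_le
        (hTolBad P hP l hl h5 hc h2 h5' h6 hg T))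
    hregBad

/-- **`abc_of_offRemainder_sigmaHBand_le_tol_content_hregC` — the θ-CUT of the same end (director-abc R14′: the content socket).** Explicit 2 = [TOL-C]
«`R_{Σ₈(T)}(T) ≤ ((l+1)/4)·5·d*·l` at the genuine data of admissible `(P, l)` ON THE CONTENT LOCUS `6(1 + 20 d_mod/l)(log-diff + log-cond) + 120·d*·l <
log q^{∤{2,l}}(λ)` of [IUTchIV] Thm. 1.10's display» · [CONE-C] `hregC` (abc-iut-C-cert-1's `ABC_of_cor312C_of_hullRegimeC` binder VERBATIM) ⟹ `ABC`
(abc-iut-rh2-q2-eq `abc_of_offRemainder_empty_le_tol_content_hregC` along `R_{Σ₈} = R_∅`). Binder by binder WEAKER-OR-EQUAL than the Szpiro-bad form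
(`szpiroBad_of_content`); off the content locus NOTHING is assumed. CONDITIONAL; nothing asserted about the hypotheses; no side taken.
[cite: Mochizuki2012, IUTchIV Thm. 1.10 pp. 22–31; Cor. 2.2 (ii) p. 46] [cite: Mochizuki2012, IUTchIII Cor. 3.12 p. 174] [claim: Mochizuki2012, status: disputed] -/
theorem abc_of_offRemainder_sigmaHBand_le_tol_content_hregC
    -- [TOL, content locus] the off-Σ₈ remainder is within q2-cond's tolerance, at the data of admissible points on the content locus
    (hTolC : ∀ P : NFPoint, P ∈ UP → ∀ l : ℕ, l.Prime → 5 ≤ l →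
      Cor22.AdmitsCore P → Cor22.CondP2 P l → Cor22.CondP5 P l → Cor22.CondP6 P l →
      6 * ((1 + 20 * (Cor22.dmod P : ℝ) / l) * (P.logDiff + Cor22.logCondAvoid P {2, l}))
          + 120 * (2 ^ 12 * 3 ^ 3 * 5 * (Cor22.dmod P : ℝ) * l) < Cor22.logQAvoid P {2, l} →
      ∀ T : Cor22.ThetaVolumeDatumAt P l, letI := T.instFieldF; letI := T.instNumberFieldF; letI := T.instAlgebraF; letI := T.instFieldK;
        letI := T.instNumberFieldK; letI := T.instAlgebraK; letI := T.instFieldFbar; letI := T.instAlgebraFbar;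
        letI := T.instAlgebraKFbar; letI := T.instIsElliptic;
      offRemainder
        (settingPrVolSharp (pilotDataOfK T.D T.K) (logvAnalytic_analyticLogv (F := T.K)) (M P l T) (archPk P l T) (archSub P l T) (Ψ P l T)
          (act P l T) (Mmod P l T) (region P l T) (n P l T) (lat P l T) (sig P l T) (split P l T) (qData P l T)
          (exists_realising_qIdeles_pilotDataOfK T.D).choose
          (exists_realising_thetaIdeles_pilotDataOfK T.D).choose
          (exists_realising_qIdeles_pilotDataOfK T.D).choose_spec.1
          (exists_realising_qIdeles_pilotDataOfK T.D).choose_spec.2.1)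
        (RHHeightClassSigmaDoor.sigmaHBand (pilotDataOfK T.D T.K)) ≤
        ((l : ℝ) + 1) / 4 * (5 * ((((2 ^ 12 * 3 ^ 3 * 5 * Cor22.dmod P : ℕ) : ℝ)) * l)))
    -- [CONE, content locus] `hregC`, abc-iut-C-cert-1's binder VERBATIM
    (hregC : ∀ P : NFPoint, P ∈ UP → ∀ l : ℕ, l.Prime → 5 ≤ l →
      Cor22.AdmitsCore P → Cor22.CondP2 P l → Cor22.CondP5 P l → Cor22.CondP6 P l →
      6 * ((1 + 20 * (Cor22.dmod P : ℝ) / l) * (P.logDiff + Cor22.logCondAvoid P {2, l}))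
          + 120 * (2 ^ 12 * 3 ^ 3 * 5 * (Cor22.dmod P : ℝ) * l) < Cor22.logQAvoid P {2, l} →
      ∀ T : Cor22.ThetaVolumeDatumAt P l,
        (letI := T.instFieldF; letI := T.instNumberFieldF; letI := T.instAlgebraF; letI := T.instFieldK
         letI := T.instNumberFieldK; letI := T.instAlgebraK; letI := T.instFieldFbar; letI := T.instAlgebraFbar
         letI := T.instAlgebraKFbar; letI := T.instIsElliptic
         ¬ (∀ p ∈ T.I.supportPrimes, ∀ v w : placesOver (fieldOfModuli T.E) p,
            (Summit.ABC.IUTFork.DHData.ofInput T.I).logQloc p v = (Summit.ABC.IUTFork.DHData.ofInput T.I).logQloc p w)) →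
        T.HullEstimateOf
          (((l : ℝ) + 1) / 4 *
            ((1 + 12 * (Cor22.dmod P : ℝ) / l) * (P.logDiff + Cor22.logCondAvoid P {2, l})
              + 2 * Real.log l + 52
              + 20 / 3 * Real.log (((2 ^ 12 * 3 ^ 3 * 5 * Cor22.dmod P : ℕ) : ℝ) * (l : ℝ))
                * (Nat.primeCounting (2 ^ 12 * 3 ^ 3 * 5 * Cor22.dmod P * l) : ℝ))))
    : _root_.ABC :=
  RH.SigmaStrataEq.abc_of_offRemainder_empty_le_tol_content_hregC M archPk archSub Ψ act Mmod region n lat sig split qData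
    (fun P hP l hl h5 hc h2 h5' h6 hct T => by
      letI := T.instFieldF; letI := T.instNumberFieldF; letI := T.instAlgebraF; letI := T.instFieldK
      letI := T.instNumberFieldK; letI := T.instAlgebraK; letI := T.instFieldFbar; letI := T.instAlgebraFbar
      letI := T.instAlgebraKFbar; letI := T.instIsElliptic
      exact (offRemainder_sigmaHBand_eq_offRemainder_empty T.D (M P l T) (archPk P l T) (archSub P l T) (Ψ P l T) (act P l T)
        (Mmod P l T) (region P l T) (n P l T) (lat P l T) (sig P l T) (split P l T) (qData P l T)).symm.trans_le
        (hTolC P hP l hl h5 hc h2 h5' h6 hct T))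
    hregC

end Recut

end Summit.ABC.IUTFork.Repair.RHHeightClassSigmaAbc

end
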